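import Literature.NumberTheory.Sieve.Maynard2016Lemma85
import Literature.NumberTheory.Sieve.FGKMT2018Section8Toolbox
import HarnessLib

/-!
# FGKMT 2018 Theorem 6 (7.12) / Maynard 2016 Prop. 9.1 (`𝒜 = ℤ`): the `λ_max`-error term is negligible

Sources: J. Maynard, *Dense clusters of primes in subsets*, Compositio Math. 152 (2016)
[Maynard2016DenseClusters], proof of Proposition 9.1 p. 19 («… the error terms contribute
`≪ λ_max² |𝒜(x)| … = o(main term)` by Lemma 8.5»), Lemma 8.1 p. 15, Lemma 8.5 p. 17, Lemma 8.6 p. 18;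
K. Ford, B. Green, S. Konyagin, J. Maynard, T. Tao, *Long gaps between primes*, JAMS 31 (2018)
[FordGreenKonyaginMaynardTao2018], Theorem 6 (7.12) p. 21 and (7.15) p. 22.

PROVED here (no named facts), in the frame `FGKMT2018.Prop61Frame` of [FGKMT, Thm 6] /
[Maynard, Prop. 6.1] and for `F = F_k`:

* `eventually_two_mul_log_pow_le_rpow` — `(2k log k)^k ≤ x^ε` for `k ≤ (log x)^{1/5}` (the size of
  the Lemma 8.6 lower bound `I_k(F) ≫ (2k log k)^{−k}`);
* `sum_abs_lamVar_sq_frame` — `(∑_{d ∈ 𝒟_k} |λ_d|)² ≤ X^{2/9+ε}` (Lemma 8.5 (i) in the frame,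
  `maynard_lemma85i_frame`, with the support count `#{d : ∏ dᵢ < R} ≤ R(1 + log R)^k`);
* `prop91_lamErr_le_rpow` — the last error term of `abs_sum_sieveWt_sub_rFoldSum_le`,
  `φ_ω(W) (∑_d |λ_d|)² ≤ X^{2/9+ε}` (`φ_ω(W) ≤ W ≤ 4^{2k²} = x^{o(1)}`);
* **`rpow_le_mainTermA_frame`** — the main term of (7.12) is large:
  `X^{1−ε} ≤ (B/φ(B))^k 𝔖_B(𝓛) #𝒜(X) (log R)^k I_k(F)` (from `𝔖_B(𝓛) ≥ e^{−7k}` [Maynard, Lemma 8.1],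
  `I_k(F) ≫ (2k log k)^{−k}` [Maynard, Lemma 8.6], `#𝒜(X) ≥ X − 1`, `log R ≥ 1/2`, all `= X^{1−o(1)}`
  for `k ≤ (log x)^{1/5}`);
* **`prop91_lamErr_le_mainTermA`** — hence `φ_ω(W) (∑_d |λ_d|)² ≤ (log X)^{−1/10} · mainTermA`, i.e. the
  `λ_max`-part of the error in Prop. 9.1 is within the `O(log^{−1/10} X)`-tolerance of (7.12).

## References
* J. Maynard, *Dense clusters of primes in subsets*, Compositio Math. 152 (2016), Prop. 9.1,
  Lemmas 8.1, 8.5, 8.6 [Maynard2016DenseClusters].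
* K. Ford, B. Green, S. Konyagin, J. Maynard, T. Tao, *Long gaps between primes*, JAMS 31 (2018),
  Thm 6 (7.12), (7.15) [FordGreenKonyaginMaynardTao2018].
-/

noncomputable section

open Finset Filter

namespace Literature.NumberTheory.Sieve.FGKMT2018

variable {k : ℕ}

/-! ### Growth facts of the regime `k ≤ (log x)^{1/5}` -/

/-- In the regime `k ≤ (log x)^{1/5}`: for every `ε > 0`, eventually `(2k log k)^k ≤ x^ε`
(`(2k log k)^k ≤ (2k²)^k ≤ e^{2k³}` and `k³ ≤ (log x)^{3/5}`).
[cite: Maynard2016DenseClusters, Lemma 8.6 p. 18 (I_k ≫ (2k log k)^{-k}); FordGreenKonyaginMaynardTao2018, §8 p. 23 (I_k = x^{o(1)})] -/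
theorem eventually_two_mul_log_pow_le_rpow {ε : ℝ} (hε : 0 < ε) :
    ∀ᶠ x : ℕ in atTop, ∀ k : ℕ, (k : ℝ) ≤ Real.log x ^ ((1 : ℝ) / 5) →
      (2 * (k : ℝ) * Real.log k) ^ k ≤ (x : ℝ) ^ ε := by
  have hT : Tendsto (fun x : ℕ => Real.log x ^ ((2 : ℝ) / 5)) atTop atTop :=
    (tendsto_rpow_atTop (by norm_num)).comp (Real.tendsto_log_atTop.comp tendsto_natCast_atTop_atTop)
  filter_upwards [hT.eventually_ge_atTop (2 / ε), eventually_ge_atTop 3] with x hx hx3 k hk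
  have hx3' : (3 : ℝ) ≤ x := by exact_mod_cast hx3
  have hx0 : (0 : ℝ) < x := by linarith
  set ℓ := Real.log (x : ℝ) with hℓ
  have hℓ1 : 1 ≤ ℓ := by
    rw [hℓ, Real.le_log_iff_exp_le (by linarith)]
    exact (Real.exp_one_lt_d9.le.trans (by norm_num)).trans hx3'
  have hℓ0 : 0 ≤ ℓ := zero_le_one.trans hℓ1
  have hk0 : (0 : ℝ) ≤ k := Nat.cast_nonneg k
  have hlogk : 0 ≤ Real.log (k : ℝ) := Real.log_natCast_nonneg k
  have h1 : 2 * (k : ℝ) * Real.log k ≤ 2 * (k : ℝ) ^ 2 := by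
    have := Real.log_le_self hk0
    nlinarith
  have h2 : 2 * (k : ℝ) ^ 2 ≤ Real.exp (2 * (k : ℝ) ^ 2) := by
    linarith [Real.add_one_le_exp (2 * (k : ℝ) ^ 2)]
  have hk3 : (k : ℝ) ^ 3 ≤ ℓ ^ ((3 : ℝ) / 5) := by
    have h := pow_le_pow_left₀ hk0 hk 3
    rw [← Real.rpow_natCast (ℓ ^ ((1 : ℝ) / 5)) 3, ← Real.rpow_mul hℓ0] at h
    norm_num at h
    exact h
  have h35 : ℓ ^ ((2 : ℝ) / 5) * ℓ ^ ((3 : ℝ) / 5) = ℓ := by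
    rw [← Real.rpow_add' hℓ0 (by norm_num)]; norm_num
  have hx' : (2 : ℝ) ≤ ε * ℓ ^ ((2 : ℝ) / 5) := by
    rw [div_le_iff₀ hε] at hx; linarith
  have hexp : ((k : ℕ) : ℝ) * (2 * (k : ℝ) ^ 2) ≤ ε * ℓ := by
    calc ((k : ℕ) : ℝ) * (2 * (k : ℝ) ^ 2) = 2 * (k : ℝ) ^ 3 := by ring
      _ ≤ 2 * ℓ ^ ((3 : ℝ) / 5) := by linarith
      _ ≤ ε * ℓ ^ ((2 : ℝ) / 5) * ℓ ^ ((3 : ℝ) / 5) :=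
          mul_le_mul_of_nonneg_right hx' (Real.rpow_nonneg hℓ0 _)
      _ = ε * ℓ := by rw [mul_assoc, h35]
  calc (2 * (k : ℝ) * Real.log k) ^ k ≤ (Real.exp (2 * (k : ℝ) ^ 2)) ^ k :=
        pow_le_pow_left₀ (by positivity) (h1.trans h2) k
    _ = Real.exp ((k : ℝ) * (2 * (k : ℝ) ^ 2)) := (Real.exp_nat_mul _ _).symm
    _ ≤ Real.exp (ε * ℓ) := Real.exp_le_exp.2 hexp
    _ = (x : ℝ) ^ ε := by rw [Real.rpow_def_of_pos hx0, mul_comm]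

/-- In the frame: `x^{η/2} ≤ X^η` for `η ≥ 0` (as `x ≥ 4` and `X ≥ x/2 ≥ x^{1/2}`). [folklore] -/
private theorem rpow_half_le_rpow {x X η : ℝ} (hx : 4 ≤ x) (hX : x / 2 ≤ X) (hη : 0 ≤ η) :
    x ^ (η / 2) ≤ X ^ η := by
  have hx0 : 0 < x := by linarith
  rw [show η / 2 = (1 / 2 : ℝ) * η by ring, Real.rpow_mul hx0.le]
  refine Real.rpow_le_rpow (by positivity) ?_ hη
  have hs : x ^ ((1 : ℝ) / 2) * x ^ ((1 : ℝ) / 2) = x := by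
    rw [← Real.rpow_add hx0]; norm_num
  have h2 : (2 : ℝ) ≤ x ^ ((1 : ℝ) / 2) := by
    have h := Real.rpow_le_rpow (by norm_num) hx (by norm_num : (0 : ℝ) ≤ 1 / 2)
    rwa [show (4 : ℝ) = 2 ^ (2 : ℝ) by norm_num, ← Real.rpow_mul (by norm_num),
      show (2 : ℝ) * (1 / 2) = 1 by norm_num, Real.rpow_one] at h
  nlinarith [Real.rpow_nonneg hx0.le ((1 : ℝ) / 2)]

/-! ### `(∑_d |λ_d|)² ≤ X^{2/9+ε}` and `φ_ω(W)(∑_d |λ_d|)² ≤ X^{2/9+ε}` -/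

/-- **Lemma 8.5 (i) × support, in the frame**: for every `ε > 0`, for all large `x`, uniformly in the
frame of Prop. 6.1 (`k ≥ 2`), `(∑_{d ∈ 𝒟_k(𝓛)} |λ_d|)² ≤ (λ_max · R(1 + log R)^k)² ≤ X^{2/9+ε}`
(`λ_max ≤ 2(2e⁵ log R)^k`, `R ≤ X^{1/9}`, `(log x)^{O(k)}, C^k = x^{o(1)}`).
[cite: Maynard2016DenseClusters, Lemma 8.5 (i),(iii) p. 17, proof of Prop. 9.1 p. 19; FordGreenKonyaginMaynardTao2018, Thm 6 (7.15) p. 22] -/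
theorem sum_abs_lamVar_sq_frame {ε : ℝ} (hε : 0 < ε) :
    Prop61Frame 2 fun B k L X R =>
      (∑ d ∈ dkBox L B R, |lamVar L B R (MaynardDense.F k) d|) ^ 2 ≤ X ^ ((2 : ℝ) / 9 + ε) := by
  have hF := maynard_lemma85i_frame
  have hε4 : 0 < ε / 4 := by linarith
  have hA : (1 : ℝ) ≤ 1296 * Real.exp 5 ^ 2 := by
    have := Real.one_lt_exp_iff.2 (by norm_num : (0 : ℝ) < 5)
    nlinarith
  unfold Prop61Frame at hF ⊢
  filter_upwards [hF, eventually_one_add_log_pow_le_rpow 4 hε4, eventually_const_pow_le_rpow hA 1 hε4,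
    eventually_ge_atTop 4] with x hlam hlog hconst hx4 B hB hBx k L X R hCk hk hadm hnd hcoef hX1 hX2
    hR1 hR2
  have hΛ := hlam B hB hBx k L X R hCk hk hadm hnd hcoef hX1 hX2 hR1 hR2
  have hlogk := hlog k hk
  have hconstk := hconst k hk
  rw [one_mul] at hconstk
  have hx4' : (4 : ℝ) ≤ x := by exact_mod_cast hx4
  have hx0 : (0 : ℝ) < x := by linarith
  set ℓ := Real.log (x : ℝ) with hℓ
  have hℓ1 : 1 ≤ ℓ := by
    rw [hℓ, Real.le_log_iff_exp_le (by linarith)]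
    have h3 : Real.exp 1 ≤ 3 := Real.exp_one_lt_d9.le.trans (by norm_num)
    linarith
  have hℓ0 : 0 ≤ ℓ := zero_le_one.trans hℓ1
  have hℓx : ℓ ≤ x := Real.log_le_self hx0.le
  have hX2' : (2 : ℝ) ≤ X := by linarith
  have hX0 : 0 < X := by linarith
  have hX1' : (1 : ℝ) ≤ X := by linarith
  have hR1' : (1 : ℝ) < R := by
    have : (1 : ℝ) < X ^ ((1 : ℝ) / 30) := Real.one_lt_rpow (by linarith) (by norm_num)
    linarith
  have hRX : R ≤ X := hR2.trans (by
    conv_rhs => rw [← Real.rpow_one X]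
    exact Real.rpow_le_rpow_of_exponent_le hX1' (by norm_num))
  have hRx3 : R ≤ (x : ℝ) ^ 3 := by
    refine hRX.trans (hX2.trans ?_)
    have : ℓ ^ 2 ≤ (x : ℝ) ^ 2 := pow_le_pow_left₀ hℓ0 hℓx 2
    calc (x : ℝ) * ℓ ^ 2 ≤ x * (x : ℝ) ^ 2 := mul_le_mul_of_nonneg_left this hx0.le
      _ = (x : ℝ) ^ 3 := by ring
  have hlogR0 : 0 ≤ Real.log R := Real.log_nonneg hR1'.le
  have hlogR : Real.log R ≤ 3 * ℓ := by
    calc Real.log R ≤ Real.log ((x : ℝ) ^ 3) := Real.log_le_log (by linarith) hRx3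
      _ = 3 * ℓ := by rw [Real.log_pow, hℓ]; norm_num
  set a := 1 + ℓ with ha
  have ha1 : 1 ≤ a := by linarith
  have h1R : 1 + Real.log R ≤ 3 * a := by linarith
  have hlR : Real.log R ≤ 3 * a := by linarith
  set Λ := 2 * (2 * Real.exp 5 * Real.log R) ^ k with hΛdef
  have hΛ0 : 0 ≤ Λ := by positivity
  set S := ∑ d ∈ dkBox L B R, |lamVar L B R (MaynardDense.F k) d| with hS
  have hS0 : 0 ≤ S := Finset.sum_nonneg fun _ _ => abs_nonneg _
  have hSle : S ≤ Λ * (R * (1 + Real.log R) ^ k) :=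
    sum_abs_lamVar_F_le L B hR1' hΛ0 fun d _ => hΛ d
  have hT : Λ * (R * (1 + Real.log R) ^ k) ≤ 2 * ((18 * Real.exp 5) * a ^ 2) ^ k * R := by
    have h1 : (2 * Real.exp 5 * Real.log R) ^ k ≤ (2 * Real.exp 5 * (3 * a)) ^ k :=
      pow_le_pow_left₀ (by positivity) (mul_le_mul_of_nonneg_left hlR (by positivity)) k
    have h2 : (1 + Real.log R) ^ k ≤ (3 * a) ^ k :=
      pow_le_pow_left₀ (by linarith) h1R k
    have h3 : (2 * Real.exp 5 * (3 * a)) * (3 * a) = (18 * Real.exp 5) * a ^ 2 := by ring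
    calc Λ * (R * (1 + Real.log R) ^ k)
        ≤ 2 * (2 * Real.exp 5 * (3 * a)) ^ k * (R * (3 * a) ^ k) := by
          refine mul_le_mul (mul_le_mul_of_nonneg_left h1 (by norm_num))
            (mul_le_mul_of_nonneg_left h2 (by linarith)) (by positivity) (by positivity)
      _ = 2 * ((2 * Real.exp 5 * (3 * a)) * (3 * a)) ^ k * R := by
          rw [mul_pow (2 * Real.exp 5 * (3 * a)) (3 * a) k]; ring
      _ = 2 * ((18 * Real.exp 5) * a ^ 2) ^ k * R := by rw [h3]
  have hR2' : R ^ 2 ≤ X ^ ((2 : ℝ) / 9) := by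
    have h := pow_le_pow_left₀ (by linarith : (0 : ℝ) ≤ R) hR2 2
    rw [← Real.rpow_natCast (X ^ ((1 : ℝ) / 9)) 2, ← Real.rpow_mul hX0.le] at h
    norm_num at h
    exact h
  have hconst' : (2 * (18 * Real.exp 5) ^ k) ^ 2 ≤ (x : ℝ) ^ (ε / 4) := by
    have hk1 : k ≠ 0 := by omega
    have h4 : (4 : ℝ) ≤ 4 ^ k := by
      calc (4 : ℝ) = 4 ^ 1 := (pow_one _).symm
        _ ≤ 4 ^ k := pow_le_pow_right₀ (by norm_num) (Nat.one_le_iff_ne_zero.2 hk1)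
    calc (2 * (18 * Real.exp 5) ^ k) ^ 2 = 4 * ((18 * Real.exp 5) ^ 2) ^ k := by
          rw [mul_pow, ← pow_mul, mul_comm k 2, pow_mul]; norm_num
      _ ≤ 4 ^ k * ((18 * Real.exp 5) ^ 2) ^ k := mul_le_mul_of_nonneg_right h4 (by positivity)
      _ = (4 * (18 * Real.exp 5) ^ 2) ^ k := by rw [← mul_pow]
      _ = (1296 * Real.exp 5 ^ 2) ^ k := by congr 1; ring
      _ ≤ (x : ℝ) ^ (ε / 4) := hconstk
  have hapow : ((a ^ 2) ^ k) ^ 2 ≤ (x : ℝ) ^ (ε / 4) := by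
    rw [← pow_mul, ← pow_mul, show 2 * (k * 2) = 4 * k by ring]; exact hlogk
  have hxX : (x : ℝ) ^ (ε / 4) * (x : ℝ) ^ (ε / 4) ≤ X ^ ε := by
    rw [← Real.rpow_add hx0, show ε / 4 + ε / 4 = ε / 2 by ring]
    exact rpow_half_le_rpow hx4' hX1 hε.le
  calc S ^ 2 ≤ (2 * ((18 * Real.exp 5) * a ^ 2) ^ k * R) ^ 2 :=
        pow_le_pow_left₀ hS0 (hSle.trans hT) 2
    _ = (2 * (18 * Real.exp 5) ^ k) ^ 2 * ((a ^ 2) ^ k) ^ 2 * R ^ 2 := by rw [mul_pow]; ring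
    _ ≤ (x : ℝ) ^ (ε / 4) * (x : ℝ) ^ (ε / 4) * X ^ ((2 : ℝ) / 9) := by
        refine mul_le_mul (mul_le_mul hconst' hapow (by positivity) (by positivity)) hR2'
          (by positivity) (by positivity)
    _ ≤ X ^ ε * X ^ ((2 : ℝ) / 9) := mul_le_mul_of_nonneg_right hxX (by positivity)
    _ = X ^ ((2 : ℝ) / 9 + ε) := by rw [mul_comm, ← Real.rpow_add hX0]

/-- **The `λ_max`-error term of Prop. 9.1 is `≤ X^{2/9+ε}`**: for every `ε > 0`, in the frame (`k ≥ 2`),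
`φ_ω(W) (∑_{d ∈ 𝒟_k} |λ_d|)² ≤ X^{2/9+ε}` (`φ_ω(W) ≤ W ≤ 4^{2k²} = x^{o(1)}`).
This is the last term of `abs_sum_sieveWt_sub_rFoldSum_le`.
[cite: Maynard2016DenseClusters, proof of Prop. 9.1 p. 19 (error ≪ λ_max² …); FordGreenKonyaginMaynardTao2018, Thm 6 (7.12), (7.15) pp. 21–22] -/
theorem prop91_lamErr_le_rpow {ε : ℝ} (hε : 0 < ε) :
    Prop61Frame 2 fun B k L X R =>
      phiOmega L (wCut k B) * (∑ d ∈ dkBox L B R, |lamVar L B R (MaynardDense.F k) d|) ^ 2 ≤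
        X ^ ((2 : ℝ) / 9 + ε) := by
  have hε2 : 0 < ε / 2 := by linarith
  have hε4 : 0 < ε / 4 := by linarith
  have hS := sum_abs_lamVar_sq_frame hε2
  unfold Prop61Frame at hS ⊢
  filter_upwards [hS, eventually_four_pow_le_rpow hε4, eventually_ge_atTop 4] with x hxS h4 hx4 B hB
    hBx k L X R hCk hk hadm hnd hcoef hX1 hX2 hR1 hR2
  have h1 := hxS B hB hBx k L X R hCk hk hadm hnd hcoef hX1 hX2 hR1 hR2
  have h2 : phiOmega L (wCut k B) ≤ X ^ (ε / 2) := by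
    refine (phiOmega_wCut_le_four_pow L B).trans ((h4 k hk).trans ?_)
    have hx4' : (4 : ℝ) ≤ x := by exact_mod_cast hx4
    have := rpow_half_le_rpow hx4' hX1 hε2.le
    rwa [show ε / 2 / 2 = ε / 4 by ring] at this
  have hX0 : 0 < X := by
    have hx4' : (4 : ℝ) ≤ x := by exact_mod_cast hx4
    linarith
  calc phiOmega L (wCut k B) * (∑ d ∈ dkBox L B R, |lamVar L B R (MaynardDense.F k) d|) ^ 2
      ≤ X ^ (ε / 2) * X ^ ((2 : ℝ) / 9 + ε / 2) :=
        mul_le_mul h2 h1 (by positivity) (by positivity)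
    _ = X ^ ((2 : ℝ) / 9 + ε) := by
        rw [← Real.rpow_add hX0]; ring_nf

/-! ### The main term of (7.12) is `X^{1−o(1)}` -/

/-- **The main term of Prop. 9.1 / (7.12) is large**: for every `ε > 0` there is `C` such that, in
the frame (from `k ≥ C` on), `X^{1−ε} ≤ (B/φ(B))^k 𝔖_B(𝓛) #𝒜(X) (log R)^k I_k(F)`
(`B/φ(B) ≥ 1`; `𝔖_B(𝓛) ≥ e^{−7k}` [Maynard, Lemma 8.1]; `#𝒜(X) ≥ X − 1`; `log R ≥ 1/2`;
`I_k(F) ≥ K⁻¹ (2k log k)^{−k}` [Maynard, Lemma 8.6]; and `e^{7k}, 2^k, (2k log k)^k = x^{o(1)}` for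
`k ≤ (log x)^{1/5}`).
[cite: Maynard2016DenseClusters, Lemma 8.1 p. 15, Lemma 8.6 p. 18, proof of Prop. 9.1 p. 19; FordGreenKonyaginMaynardTao2018, Thm 6 (7.12) p. 21, §8 p. 23 (𝔖 ≥ x^{-o(1)}, I_k = x^{o(1)})] -/
theorem rpow_le_mainTermA_frame {ε : ℝ} (hε : 0 < ε) :
    ∃ C : ℕ, Prop61Frame C fun B k L X R =>
      X ^ (1 - ε) ≤ mainTermA L B X R (MaynardDense.IF k) := by
  obtain ⟨C₀, K₀, hK₀, h0⟩ := MaynardDense.exists_IF_JF_bounds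
  refine ⟨max C₀ 2, ?_⟩
  -- wlog `ε ≤ 1/2`
  set ε₀ : ℝ := min ε (1 / 2) with hε₀
  have hε₀pos : 0 < ε₀ := lt_min hε (by norm_num)
  have hε₀le : ε₀ ≤ ε := min_le_left _ _
  have hε₀h : ε₀ ≤ 1 / 2 := min_le_right _ _
  set η : ℝ := ε₀ / 8 with hη
  have hηpos : 0 < η := by positivity
  have hA7 : (1 : ℝ) ≤ Real.exp 7 := Real.one_le_exp (by norm_num)
  have hA2 : (1 : ℝ) ≤ 2 := by norm_num
  -- `16 K₀ ≤ (x/2)^{5ε₀/8}` eventually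
  have hP : Tendsto (fun x : ℕ => ((x : ℝ) / 2) ^ (5 * η)) atTop atTop :=
    (tendsto_rpow_atTop (by positivity)).comp
      (tendsto_natCast_atTop_atTop.atTop_div_const (by norm_num))
  unfold Prop61Frame
  filter_upwards [eventually_const_pow_le_rpow hA7 1 hηpos, eventually_const_pow_le_rpow hA2 1 hηpos,
    eventually_two_mul_log_pow_le_rpow hηpos, eventually_lemma85_aux, hP.eventually_ge_atTop (16 * K₀),
    eventually_ge_atTop 4] with x h7 h2 hkk haux h16 hx4 B hB hBx k L X R hCk hk hadm hnd hcoef hX1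
    hX2 hR1 hR2
  have hC₀k : C₀ ≤ k := (le_max_left _ _).trans hCk
  have hk2 : 2 ≤ k := (le_max_right _ _).trans hCk
  have hk1 : 1 ≤ k := by omega
  obtain ⟨hIpos, hIlow, -, -⟩ := h0 k hC₀k
  obtain ⟨hN2, -, -⟩ := haux k hk X R hX1 hR1
  have h7k := h7 k hk
  have h2k := h2 k hk
  have hkkk := hkk k hk
  rw [one_mul] at h7k h2k
  have hx4' : (4 : ℝ) ≤ x := by exact_mod_cast hx4
  have hx0 : (0 : ℝ) < x := by linarith
  have hX2' : (2 : ℝ) ≤ X := by linarith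
  have hX0 : 0 < X := by linarith
  have hX1' : (1 : ℝ) ≤ X := by linarith
  -- `R ≥ 2`, `log R ≥ 1/2`
  have hR0 : 0 ≤ R := le_trans (Real.rpow_nonneg hX0.le _) hR1
  have hR2R : (2 : ℝ) ≤ R := by
    have : ((⌊R⌋₊ : ℕ) : ℝ) ≤ R := Nat.floor_le hR0
    have h2 : (2 : ℝ) ≤ ((⌊R⌋₊ : ℕ) : ℝ) := by exact_mod_cast hN2
    linarith
  have hlogR : 1 / 2 ≤ Real.log R := by
    have := Real.log_le_log (by norm_num) hR2R
    linarith [Real.log_two_gt_d9]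
  -- the five factors
  set y : ℝ := (x : ℝ) ^ η with hy
  have hy0 : 0 < y := Real.rpow_pos_of_pos hx0 _
  have hyX : y ≤ 2 * X ^ η := by
    have h1 : y ≤ (2 * X) ^ η := Real.rpow_le_rpow hx0.le (by linarith) hηpos.le
    have h2 : (2 * X) ^ η = (2 : ℝ) ^ η * X ^ η := Real.mul_rpow (by norm_num) hX0.le
    have h3 : (2 : ℝ) ^ η ≤ 2 := by
      conv_rhs => rw [← Real.rpow_one 2]
      refine Real.rpow_le_rpow_of_exponent_le (by norm_num) ?_
      rw [hη]; linarith
    calc y ≤ (2 : ℝ) ^ η * X ^ η := h1.trans h2.le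
      _ ≤ 2 * X ^ η := mul_le_mul_of_nonneg_right h3 (Real.rpow_nonneg hX0.le _)
  have f1 : 1 ≤ bOverPhi B ^ k := one_le_pow₀ (one_le_bOverPhi hB)
  have f2 : 1 / y ≤ singSeriesExcl L B := by
    refine le_trans ?_ (exp_neg_seven_mul_le_singSeriesExcl hadm hnd hk1 B)
    rw [Real.exp_neg, ← one_div]
    have h7k' : Real.exp (7 * (k : ℝ)) ≤ y := by rw [mul_comm, Real.exp_nat_mul]; exact h7k
    exact one_div_le_one_div_of_le (Real.exp_pos _) h7k'
  have f3 : X / 2 ≤ (#(dyadZ X) : ℝ) := by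
    have := (card_dyadZ_bounds hX0.le).1
    linarith
  have f4 : 1 / y ≤ Real.log R ^ k := by
    have h : (1 / 2 : ℝ) ^ k ≤ Real.log R ^ k := pow_le_pow_left₀ (by norm_num) hlogR k
    refine le_trans ?_ h
    rw [one_div_pow]
    exact one_div_le_one_div_of_le (by positivity) h2k
  have f5 : 1 / y / K₀ ≤ MaynardDense.IF k := by
    have hb0 : 0 < 2 * (k : ℝ) * Real.log k := by
      have hk2r : (2 : ℝ) ≤ k := by exact_mod_cast hk2
      have : Real.log 2 ≤ Real.log k := Real.log_le_log (by norm_num) hk2r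
      have hl2 := Real.log_two_gt_d9
      nlinarith
    have hrw : (2 * (k : ℝ) * Real.log k) ^ (-(k : ℝ)) = 1 / (2 * (k : ℝ) * Real.log k) ^ k := by
      rw [Real.rpow_neg hb0.le, Real.rpow_natCast, one_div]
    rw [hrw] at hIlow
    rw [div_le_iff₀ hK₀, mul_comm]
    refine le_trans ?_ hIlow
    exact one_div_le_one_div_of_le (pow_pos hb0 k) hkkk
  -- product of the lower bounds
  have hmain : (X / 2) * (1 / y) ^ 3 / K₀ ≤ mainTermA L B X R (MaynardDense.IF k) := by
    unfold mainTermA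
    have e : (X / 2) * (1 / y) ^ 3 / K₀ = 1 * (1 / y) * (X / 2) * (1 / y) * (1 / y / K₀) := by ring
    rw [e]
    have hy1 : 0 ≤ 1 / y := by positivity
    refine mul_le_mul ?_ f5 (by positivity) ?_
    · refine mul_le_mul ?_ f4 hy1 ?_
      · refine mul_le_mul ?_ f3 (by positivity) ?_
        · exact mul_le_mul f1 f2 hy1 (le_trans zero_le_one f1)
        · exact mul_nonneg (le_trans zero_le_one f1) (le_trans hy1 f2)
      · exact mul_nonneg (mul_nonneg (le_trans zero_le_one f1) (le_trans hy1 f2)) (by positivity)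
    · refine mul_nonneg (mul_nonneg (mul_nonneg (le_trans zero_le_one f1) (le_trans hy1 f2))
        (by positivity)) (le_trans hy1 f4)
  -- `X^{1-ε} ≤ X^{1-ε₀} ≤ (X/2) y⁻³ / K₀`
  have hXε : X ^ (1 - ε) ≤ X ^ (1 - ε₀) :=
    Real.rpow_le_rpow_of_exponent_le hX1' (by linarith)
  refine hXε.trans (le_trans ?_ hmain)
  -- `(1/y)^3 ≥ 1/(8 X^{3η})`
  have hy3 : 1 / (8 * X ^ (3 * η)) ≤ (1 / y) ^ 3 := by
    rw [one_div_pow]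
    refine one_div_le_one_div_of_le (pow_pos hy0 3) ?_
    calc y ^ 3 ≤ (2 * X ^ η) ^ 3 := pow_le_pow_left₀ hy0.le hyX 3
      _ = 8 * (X ^ η) ^ 3 := by ring
      _ = 8 * X ^ (3 * η) := by
          rw [← Real.rpow_natCast (X ^ η) 3, ← Real.rpow_mul hX0.le]; ring_nf
  have h16' : 16 * K₀ ≤ X ^ (5 * η) := by
    refine h16.trans ?_
    exact Real.rpow_le_rpow (by positivity) hX1 (by positivity)
  -- `X^{1-ε₀} · 16 K₀ · X^{3η} ≤ X^{1-ε₀} X^{5η} X^{3η} = X`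
  have hsplit : X ^ (1 - ε₀) * X ^ (5 * η) * X ^ (3 * η) = X := by
    rw [← Real.rpow_add hX0, ← Real.rpow_add hX0, hη]
    ring_nf
    exact Real.rpow_one X
  have hkey : X ^ (1 - ε₀) * (16 * K₀) * X ^ (3 * η) ≤ X := by
    calc X ^ (1 - ε₀) * (16 * K₀) * X ^ (3 * η) ≤ X ^ (1 - ε₀) * X ^ (5 * η) * X ^ (3 * η) := by
          refine mul_le_mul_of_nonneg_right (mul_le_mul_of_nonneg_left h16' ?_) ?_
          · exact Real.rpow_nonneg hX0.le _
          · exact Real.rpow_nonneg hX0.le _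
      _ = X := hsplit
  have hX3η : 0 < X ^ (3 * η) := Real.rpow_pos_of_pos hX0 _
  calc X ^ (1 - ε₀) = X ^ (1 - ε₀) * (16 * K₀) * X ^ (3 * η) / (16 * K₀ * X ^ (3 * η)) := by
        field_simp
    _ ≤ X / (16 * K₀ * X ^ (3 * η)) := div_le_div_of_nonneg_right hkey (by positivity)
    _ = (X / 2) * (1 / (8 * X ^ (3 * η))) / K₀ := by
        field_simp
        ring
    _ ≤ (X / 2) * (1 / y) ^ 3 / K₀ :=
        div_le_div_of_nonneg_right (mul_le_mul_of_nonneg_left hy3 (by positivity)) hK₀.le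

/-- **The `λ_max`-error of Prop. 9.1 is within the tolerance of (7.12)**: there is `C` such that, in
the frame (from `k ≥ C` on),
`φ_ω(W) (∑_{d ∈ 𝒟_k} |λ_d|)² ≤ (log X)^{−1/10} · (B/φ(B))^k 𝔖_B(𝓛) #𝒜(X) (log R)^k I_k(F)`
(`X^{1/4} (log X)^{1/10} ≤ X^{3/4}`).
[cite: Maynard2016DenseClusters, proof of Prop. 9.1 p. 19 («= o(main term)» by Lemma 8.5); FordGreenKonyaginMaynardTao2018, Thm 6 (7.12) p. 21] -/
theorem prop91_lamErr_le_mainTermA :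
    ∃ C : ℕ, Prop61Frame C fun B k L X R =>
      phiOmega L (wCut k B) * (∑ d ∈ dkBox L B R, |lamVar L B R (MaynardDense.F k) d|) ^ 2 ≤
        1 / Real.log X ^ ((1 : ℝ) / 10) * mainTermA L B X R (MaynardDense.IF k) := by
  obtain ⟨C, hC⟩ := rpow_le_mainTermA_frame (ε := 1 / 4) (by norm_num)
  have hE := prop91_lamErr_le_rpow (ε := 1 / 36) (by norm_num)
  refine ⟨max 2 C, ?_⟩
  have h := Prop61Frame.and hE hC
  unfold Prop61Frame at h ⊢
  filter_upwards [h, eventually_ge_atTop 4] with x hx hx4 B hB hBx k L X R hCk hk hadm hnd hcoef hX1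
    hX2 hR1 hR2
  obtain ⟨h1, h2⟩ := hx B hB hBx k L X R hCk hk hadm hnd hcoef hX1 hX2 hR1 hR2
  have hx4' : (4 : ℝ) ≤ x := by exact_mod_cast hx4
  have hX2' : (2 : ℝ) ≤ X := by linarith
  have hX0 : 0 < X := by linarith
  have hX1' : (1 : ℝ) ≤ X := by linarith
  have hlogX0 : 0 ≤ Real.log X := Real.log_nonneg hX1'
  -- `(log X)^{1/10} ≤ X^{1/10} ≤ X^{1/2}`
  have hl : Real.log X ^ ((1 : ℝ) / 10) ≤ X ^ ((1 : ℝ) / 2) :=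
    (Real.rpow_le_rpow hlogX0 (Real.log_le_self hX0.le) (by norm_num)).trans
      (Real.rpow_le_rpow_of_exponent_le hX1' (by norm_num))
  have hL0 : 0 < Real.log X ^ ((1 : ℝ) / 10) :=
    Real.rpow_pos_of_pos (Real.log_pos (by linarith)) _
  rw [show (2 : ℝ) / 9 + 1 / 36 = 1 / 4 by norm_num] at h1
  have h3 : X ^ ((1 : ℝ) / 4) * Real.log X ^ ((1 : ℝ) / 10) ≤ mainTermA L B X R (MaynardDense.IF k) := by
    calc X ^ ((1 : ℝ) / 4) * Real.log X ^ ((1 : ℝ) / 10) ≤ X ^ ((1 : ℝ) / 4) * X ^ ((1 : ℝ) / 2) :=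
          mul_le_mul_of_nonneg_left hl (Real.rpow_nonneg hX0.le _)
      _ = X ^ (1 - 1 / 4 : ℝ) := by rw [← Real.rpow_add hX0]; norm_num
      _ ≤ mainTermA L B X R (MaynardDense.IF k) := h2
  calc phiOmega L (wCut k B) * (∑ d ∈ dkBox L B R, |lamVar L B R (MaynardDense.F k) d|) ^ 2
      ≤ X ^ ((1 : ℝ) / 4) := h1
    _ ≤ mainTermA L B X R (MaynardDense.IF k) / Real.log X ^ ((1 : ℝ) / 10) := by
        rw [le_div_iff₀ hL0]; exact h3
    _ = 1 / Real.log X ^ ((1 : ℝ) / 10) * mainTermA L B X R (MaynardDense.IF k) := by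
        rw [div_eq_inv_mul]; simp only [one_div]

end Literature.NumberTheory.Sieve.FGKMT2018
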